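import Mathlib
import HarnessLib
import Summits.NavierStokesRegularity.NavierStokesRegularity.Theorems.UnthreadedRigidityDoorUnthreadedRigidityVirialHornCoherentCalculus

/-!
# VIRIAL HORN, W-ii (2/6): THE COHERENT FRAME `Φ_{l,k} = [s^k](W + 2Zs − Vs²)^l` and the RAISING LAWS

Route `UnthreadedRigidityDoor`, item `UnthreadedRigidity` (W2, stmt-NavierStokesRegularity-27585) — LINE g11-1 «VIRIAL HORN»,
DIRECTOR-NS KEY-NS #210 (W-ii): the ALL-DEGREE BRACKET INJECTIVITY `bracketInjective_all` (= the hypothesis `hinj` of p712484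
`windowWedgeAnalyticL_of_bracketInjective`, every `l ≥ 1`), by a kernel road that needs neither the `SO(3)`-isotypic decomposition of `Λ²𝓗_l`
nor a closed form of Legendre coefficients (ns-crc-p2 g10; `--supports stmt-NavierStokesRegularity-27585`, helper; 0 kit).

CONTENT.  Single-sum coefficient extraction (`coeff_ext_sum`, `eq_of_sum_incl_eq`), the degree weight `dg = (1,1,1,0,0)` and the azimuthal
weight `ag = (1,−1,0,1,1)` on the 5-variable ring (`weight_ext`); the generating binary form `qX = W + 2Z·s − V·s² ∈ ℂ[W,V,Z][s]` (the degree-one solid harmonic paired with the isotropic vector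
`(1−s², i(1+s²), 2s)`) and the COHERENT FRAME `Phi l k = [s^k] qX^l` (`k = 0..2l`, zero beyond: `Phi_eq_zero_of_lt`; `Phi_zero : Φ_{l,0} = W^l`);
the expansions `qs^l = Σ_k incl(Φ_{l,k}) s^k`, `qt^l = Σ_k incl(Φ_{l,k}) t^k` in the 5-variable ring; every `Φ_{l,k}` is homogeneous of degree
`l` (`isHomogeneous_Phi`), of azimuthal weight `l − k` (`isWeightedHomogeneous_Phi`) and HARMONIC (`lapC_Phi`, since `q(s)` is a null linear form);
the RAISING LAW ON THE FRAME `raise Φ_{l,k+1} = (2l − k) Φ_{l,k}`, `raise Φ_{l,0} = 0` (`raise_Phi_succ`, `raise_Phi_zero`: generating identity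
`E(q^l) = s(2W∂_W + Z∂_Z)(q^l)` and `2W∂_W + Z∂_Z = degree + weight`), whence `Φ_{l,k} ≠ 0` for `k ≤ 2l` (`Phi_ne_zero`); and THE RAISING
LAW `raise (tripleC P Q) = tripleC (raise P) Q + tripleC P (raise Q)` (`raise_tripleC`: the Jacobi identity of the Lie–Poisson bracket with
one slot `= W`), with the linearity of `raise`.

HONEST LABEL: finite-dimensional polynomial algebra about solid harmonics (W1's complex-coordinate currency `Zonal.CPoly = ℂ[W,V,Z]`,
`tripleC = −i·det(∇·,∇·,x)`, `lapC`, imported by name — nothing is re-declared); no statement about Navier–Stokes solutions is made or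
proved in this file; `UnthreadedRigidity` ⟨27585⟩, W2 and NS regularity remain OPEN.  [folklore]
-/

-- the summit and its single sub-problem share the name (CONVENTIONS §1)
set_option linter.dupNamespace false

noncomputable section

open MvPolynomial Finsupp

namespace Summit.NavierStokesRegularity.NavierStokesRegularity.Theorems.UnthreadedRigidity.VirialHorn.Coherent

open Summit.NavierStokesRegularity.NavierStokesRegularity.Theorems.PoloidalLiouville.HorizonTower.Zonal
  (CPoly wt lapC lam tripleC dotC tri)

/-! ## Single-sum extraction and the weights on the generating ring -/

/-- extraction from a finite single sum `Σ_{j < N} incl(a j) s^j`. -/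
theorem coeff_ext_sum (N : ℕ) (a : ℕ → CPoly) (d : Fin 3 →₀ ℕ) {j : ℕ} (hj : j < N) :
    coeff (ext d j 0) (∑ j' ∈ Finset.range N, incl (a j') * X 3 ^ j') = coeff d (a j) := by
  classical
  have h : (∑ j' ∈ Finset.range N, incl (a j') * X 3 ^ j') = ∑ j' ∈ Finset.range N, incl (a j') * X 3 ^ j' * X 4 ^ 0 :=
    Finset.sum_congr rfl fun j' _ => by rw [pow_zero, mul_one]
  rw [h]
  simp only [coeff_sum, coeff_ext_incl_mul, and_true]
  rw [Finset.sum_eq_single j]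
  · simp
  · intro j' _ hj'; simp [hj']
  · intro h; exact absurd (Finset.mem_range.mpr hj) h

/-- two single sums along `incl` with equal values have equal coefficients. -/
theorem eq_of_sum_incl_eq (N : ℕ) (a b : ℕ → CPoly)
    (h : ∑ j ∈ Finset.range N, incl (a j) * X 3 ^ j = ∑ j ∈ Finset.range N, incl (b j) * X 3 ^ j) {j : ℕ} (hj : j < N) :
    a j = b j := by
  ext d
  rw [← coeff_ext_sum N a d hj, ← coeff_ext_sum N b d hj, h]

/-! ## Weights on the generating ring -/

/-- degree weight: `W, V, Z ↦ 1`, `s, t ↦ 0`. -/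
def dg : Fin 5 → ℕ := ![1, 1, 1, 0, 0]

/-- azimuthal weight: `W ↦ 1`, `V ↦ −1`, `Z ↦ 0`, `s, t ↦ 1`. -/
def ag : Fin 5 → ℤ := ![1, -1, 0, 1, 1]

/-- the weight of `ext d j k` splits over the embedded part and the parameters. -/
theorem weight_ext {M : Type*} [AddCommMonoid M] (w : Fin 5 → M) (d : Fin 3 →₀ ℕ) (j k : ℕ) :
    weight w (ext d j k) = weight (w ∘ emb) d + j • w 3 + k • w 4 := by
  simp only [ext, map_add]
  rw [weight_apply, weight_apply, weight_apply, weight_apply, sum_mapDomain_index_inj emb_injective,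
    sum_single_index (by simp), sum_single_index (by simp)]
  rfl

/-- the degree weight restricts to the total degree on `W,V,Z`. -/
theorem dg_comp_emb : dg ∘ emb = (1 : Fin 3 → ℕ) := by
  funext i; fin_cases i <;> rfl

/-- the azimuthal weight restricts to W1's `wt` on `W,V,Z`. -/
theorem ag_comp_emb : ag ∘ emb = wt := by
  funext i; fin_cases i <;> rfl

/-- `s` has degree weight `0`. -/
@[simp] theorem dg_three : dg 3 = 0 := rfl
/-- `t` has degree weight `0`. -/
@[simp] theorem dg_four : dg 4 = 0 := rfl
/-- `s` has azimuthal weight `1`. -/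
@[simp] theorem ag_three : ag 3 = 1 := rfl
/-- `t` has azimuthal weight `1`. -/
@[simp] theorem ag_four : ag 4 = 1 := rfl

/-! ## The generating binary form and the coherent frame -/

/-- the generating binary form `q(s) = W + 2Z·s − V·s²` over `ℂ[W,V,Z]` (the degree-one solid harmonic paired with the isotropic vector
`(1 − s², i(1 + s²), 2s)`, written in the coordinates `W = x + iy`, `V = x − iy`, `Z = z`). -/
def qX : Polynomial CPoly :=
  Polynomial.C (X 0) + Polynomial.C (C (2 : ℂ) * X 2) * Polynomial.X - Polynomial.C (X 1) * Polynomial.X ^ 2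

/-- ★ the COHERENT FRAME of degree `l`: `Φ_{l,k} = [s^k] (W + 2Zs − Vs²)^l`, `k = 0, …, 2l` (zero beyond). -/
def Phi (l k : ℕ) : CPoly := (qX ^ l).coeff k

/-- the generating element `q(s) = W + 2Zs − Vs²` in the 5-variable ring (`s = X 3`). -/
def qs : GPoly := X 0 + C (2 : ℂ) * X 2 * X 3 - X 1 * X 3 ^ 2

/-- the generating element `q(t) = W + 2Zt − Vt²` in the 5-variable ring (`t = X 4`). -/
def qt : GPoly := X 0 + C (2 : ℂ) * X 2 * X 4 - X 1 * X 4 ^ 2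

/-- `q` is quadratic in `s`. -/
theorem natDegree_qX_le : qX.natDegree ≤ 2 := by
  unfold qX
  refine (Polynomial.natDegree_sub_le _ _).trans (max_le ?_ ?_)
  · refine (Polynomial.natDegree_add_le _ _).trans (max_le ?_ ?_)
    · simp
    · exact (Polynomial.natDegree_C_mul_le _ _).trans (by simp)
  · exact (Polynomial.natDegree_C_mul_le _ _).trans (by simp)

/-- `q^l` has degree `≤ 2l` in `s`. -/
theorem natDegree_qX_pow_lt (l : ℕ) : (qX ^ l).natDegree < 2 * l + 1 := by
  have := Polynomial.natDegree_pow_le_of_le l natDegree_qX_le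
  omega

/-- the frame is empty beyond `k = 2l`. -/
theorem Phi_eq_zero_of_lt {l k : ℕ} (h : 2 * l < k) : Phi l k = 0 :=
  Polynomial.coeff_eq_zero_of_natDegree_lt (by have := natDegree_qX_pow_lt l; omega)

/-- `Φ_{l,0} = W^l`. -/
theorem Phi_zero (l : ℕ) : Phi l 0 = X 0 ^ l := by
  simp [Phi, qX, Polynomial.coeff_zero_eq_eval_zero]

/-- substituting `s = X 3` in `q` gives the generating element `qs`. -/
theorem eval₂_qX_three : Polynomial.eval₂ (incl : CPoly →ₐ[ℂ] GPoly).toRingHom (X 3) qX = qs := by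
  simp [qX, qs, Polynomial.eval₂_add, Polynomial.eval₂_sub, Polynomial.eval₂_mul, Polynomial.eval₂_pow]

/-- substituting `t = X 4` in `q` gives the generating element `qt`. -/
theorem eval₂_qX_four : Polynomial.eval₂ (incl : CPoly →ₐ[ℂ] GPoly).toRingHom (X 4) qX = qt := by
  simp [qX, qt, Polynomial.eval₂_add, Polynomial.eval₂_sub, Polynomial.eval₂_mul, Polynomial.eval₂_pow]

/-- ★ EXPANSION: `q(s)^l = Σ_{k ≤ 2l} Φ_{l,k} s^k`. -/
theorem qs_pow_eq_sum (l : ℕ) : qs ^ l = ∑ k ∈ Finset.range (2 * l + 1), incl (Phi l k) * X 3 ^ k := by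
  rw [← eval₂_qX_three, ← Polynomial.eval₂_pow, Polynomial.eval₂_eq_sum_range' _ (natDegree_qX_pow_lt l)]
  rfl

/-- EXPANSION in the second parameter: `q(t)^l = Σ_{k ≤ 2l} Φ_{l,k} t^k`. -/
theorem qt_pow_eq_sum (l : ℕ) : qt ^ l = ∑ k ∈ Finset.range (2 * l + 1), incl (Phi l k) * X 4 ^ k := by
  rw [← eval₂_qX_four, ← Polynomial.eval₂_pow, Polynomial.eval₂_eq_sum_range' _ (natDegree_qX_pow_lt l)]
  rfl

/-! ## Degree, weight, harmonicity of the frame -/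

/-- the generating element has degree weight `1`. -/
theorem isWeightedHomogeneous_qs_dg : IsWeightedHomogeneous dg qs 1 := by
  unfold qs
  refine (weightedHomogeneousSubmodule ℂ dg 1).sub_mem ((weightedHomogeneousSubmodule ℂ dg 1).add_mem ?_ ?_) ?_
  · simpa [dg] using isWeightedHomogeneous_X ℂ dg 0
  · have h := ((isWeightedHomogeneous_X ℂ dg 2).mul (isWeightedHomogeneous_X ℂ dg 3)).C_mul (2 : ℂ)
    simpa [dg, mul_assoc] using h
  · have h := (isWeightedHomogeneous_X ℂ dg 1).mul ((isWeightedHomogeneous_X ℂ dg 3).pow 2)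
    simpa [dg] using h

/-- the generating element has azimuthal weight `1`. -/
theorem isWeightedHomogeneous_qs_ag : IsWeightedHomogeneous ag qs 1 := by
  unfold qs
  refine (weightedHomogeneousSubmodule ℂ ag 1).sub_mem ((weightedHomogeneousSubmodule ℂ ag 1).add_mem ?_ ?_) ?_
  · simpa [ag] using isWeightedHomogeneous_X ℂ ag 0
  · have h := ((isWeightedHomogeneous_X ℂ ag 2).mul (isWeightedHomogeneous_X ℂ ag 3)).C_mul (2 : ℂ)
    simpa [ag, mul_assoc] using h
  · have h := (isWeightedHomogeneous_X ℂ ag 1).mul ((isWeightedHomogeneous_X ℂ ag 3).pow 2)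
    simpa [ag] using h

/-- the coefficients of `Φ_{l,k}` are the `s^k`-coefficients of `q(s)^l`. -/
theorem coeff_Phi_eq (l k : ℕ) (d : Fin 3 →₀ ℕ) (hk : k < 2 * l + 1) : coeff d (Phi l k) = coeff (ext d k 0) (qs ^ l) := by
  rw [qs_pow_eq_sum, coeff_ext_sum _ _ _ hk]

/-- `Φ_{l,k}` is homogeneous of degree `l`. -/
theorem isHomogeneous_Phi (l k : ℕ) : (Phi l k).IsHomogeneous l := by
  by_cases hk : k < 2 * l + 1
  · intro d hd
    rw [coeff_Phi_eq l k d hk] at hd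
    have h := (isWeightedHomogeneous_qs_dg.pow l) hd
    rw [weight_ext, dg_comp_emb] at h
    simpa using h
  · rw [Phi_eq_zero_of_lt (by omega)]
    exact isHomogeneous_zero _ _ _

/-- `Φ_{l,k}` has azimuthal weight `l − k`. -/
theorem isWeightedHomogeneous_Phi (l k : ℕ) : IsWeightedHomogeneous wt (Phi l k) ((l : ℤ) - k) := by
  by_cases hk : k < 2 * l + 1
  · intro d hd
    rw [coeff_Phi_eq l k d hk] at hd
    have h := (isWeightedHomogeneous_qs_ag.pow l) hd
    rw [weight_ext, ag_comp_emb] at h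
    simp only [ag_three, ag_four, mul_one, nsmul_eq_mul] at h
    linear_combination h
  · rw [Phi_eq_zero_of_lt (by omega)]
    exact isWeightedHomogeneous_zero _ _ _

/-- the partial derivatives of the generating element. -/
theorem pderiv_zero_qs : pderiv 0 qs = 1 := by
  simp only [qs, map_add, map_sub, pderiv_mul, pderiv_pow, pderiv_C, pderiv_X_self,
    pderiv_X_of_ne (show (1 : Fin 5) ≠ 0 by decide), pderiv_X_of_ne (show (2 : Fin 5) ≠ 0 by decide),
    pderiv_X_of_ne (show (3 : Fin 5) ≠ 0 by decide)]
  ring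

/-- `∂_V q(s) = −s²`. -/
theorem pderiv_one_qs : pderiv 1 qs = -X 3 ^ 2 := by
  simp only [qs, map_add, map_sub, pderiv_mul, pderiv_pow, pderiv_C, pderiv_X_self,
    pderiv_X_of_ne (show (0 : Fin 5) ≠ 1 by decide), pderiv_X_of_ne (show (2 : Fin 5) ≠ 1 by decide),
    pderiv_X_of_ne (show (3 : Fin 5) ≠ 1 by decide)]
  ring

/-- `∂_Z q(s) = 2s`. -/
theorem pderiv_two_qs : pderiv 2 qs = C (2 : ℂ) * X 3 := by
  simp only [qs, map_add, map_sub, pderiv_mul, pderiv_pow, pderiv_C, pderiv_X_self,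
    pderiv_X_of_ne (show (0 : Fin 5) ≠ 2 by decide), pderiv_X_of_ne (show (1 : Fin 5) ≠ 2 by decide),
    pderiv_X_of_ne (show (3 : Fin 5) ≠ 2 by decide)]
  ring

/-- `q(s)` is harmonic. -/
theorem lapG_qs : lapG qs = 0 := by
  rw [lapG, pderiv_one_qs, pderiv_two_qs, map_neg, pderiv_pow, isParam_X_three.d0, (isParam_C 2).pderiv_mul_two,
    isParam_X_three.d2]
  ring

/-- `q(s)` is NULL: `∇q·∇q = 0`. -/
theorem dotG_qs_qs : dotG qs qs = 0 := by
  rw [dotG, pderiv_zero_qs, pderiv_one_qs, pderiv_two_qs, C_two]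
  ring

/-- the powers of the generating element are harmonic (it is the `l`-th power of a NULL linear form). -/
theorem lapG_qs_pow (m : ℕ) : lapG (qs ^ m) = 0 := by
  induction m with
  | zero => simp [lapG]
  | succ m ih =>
    rw [pow_succ, lapG_mul, ih, lapG_qs, zero_mul, mul_zero, zero_add, add_zero]
    cases m with
    | zero => simp [dotG]
    | succ m => rw [dotG_pow_succ_left, dotG_qs_qs]; simp

/-- ★ `Φ_{l,k}` is harmonic: `Δ̃ Φ_{l,k} = 0`. -/
theorem lapC_Phi (l k : ℕ) : lapC (Phi l k) = 0 := by
  by_cases hk : k < 2 * l + 1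
  · have h : ∑ j ∈ Finset.range (2 * l + 1), incl (lapC (Phi l j)) * X 3 ^ j
        = ∑ j ∈ Finset.range (2 * l + 1), incl ((fun _ => (0 : CPoly)) j) * X 3 ^ j := by
      have h1 := congrArg lapG (qs_pow_eq_sum l)
      rw [lapG_qs_pow, lapG_sum] at h1
      simp only [map_zero, zero_mul, Finset.sum_const_zero]
      rw [h1]
      refine Finset.sum_congr rfl fun j _ => ?_
      rw [mul_comm (incl (Phi l j)), (isParam_X_three.pow j).lapG_mul, lapG_incl, mul_comm]
    exact eq_of_sum_incl_eq _ _ _ h hk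
  · rw [Phi_eq_zero_of_lt (by omega)]
    simp [lapC]

/-! ## The raising operator on the frame -/

/-- the generating identity for the raising operator: `E(q^l) = s · (2W∂_W + Z∂_Z)(q^l)`. -/
theorem raiseG_qs_pow (l : ℕ) : raiseG (qs ^ l) = X 3 * (C (2 : ℂ) * X 0 * pderiv 0 (qs ^ l) + X 2 * pderiv 2 (qs ^ l)) := by
  rw [raiseG, pderiv_pow, pderiv_pow, pderiv_pow, pderiv_zero_qs, pderiv_one_qs, pderiv_two_qs]
  ring

/-- the degree-plus-weight operator `2W∂_W + Z∂_Z = (W∂_W + V∂_V + Z∂_Z) + Λ` on `ℂ[W,V,Z]`. -/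
def dwOp (P : CPoly) : CPoly := C (2 : ℂ) * X 0 * pderiv 0 P + X 2 * pderiv 2 P

/-- `2W∂_W + Z∂_Z = (Euler operator) + Λ`. -/
theorem dwOp_eq (P : CPoly) : dwOp P = (∑ i : Fin 3, X i * pderiv i P) + lam P := by
  rw [dwOp, Fin.sum_univ_three, lam, map_ofNat]
  ring

/-- on a polynomial of degree `l` and weight `μ`, `2W∂_W + Z∂_Z` acts as the scalar `l + μ`. -/
theorem dwOp_eq_smul {P : CPoly} {l : ℕ} {μ : ℤ} (hP : P.IsHomogeneous l) (hw : IsWeightedHomogeneous wt P μ) :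
    dwOp P = ((l : ℂ) + (μ : ℂ)) • P := by
  rw [dwOp_eq, hP.sum_X_mul_pderiv,
    Summit.NavierStokesRegularity.NavierStokesRegularity.Theorems.PoloidalLiouville.HorizonTower.Zonal.lam_eq_smul_of_isWeightedHomogeneous hw,
    add_smul, Nat.cast_smul_eq_nsmul]

/-- termwise raising under the expansion. -/
theorem raiseG_term (P : CPoly) (j : ℕ) : raiseG (incl P * X 3 ^ j) = incl (raise P) * X 3 ^ j := by
  rw [mul_comm, (isParam_X_three.pow j).raiseG_mul, raiseG_incl, mul_comm]

/-- termwise degree-plus-weight operator under the expansion. -/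
theorem dwOp_term (P : CPoly) (j : ℕ) :
    X 3 * (C (2 : ℂ) * X 0 * pderiv 0 (incl P * X 3 ^ j)) + X 3 * (X 2 * pderiv 2 (incl P * X 3 ^ j)) = incl (dwOp P) * X 3 ^ (j + 1) := by
  rw [mul_comm (incl P), (isParam_X_three.pow j).pderiv_mul_zero, (isParam_X_three.pow j).pderiv_mul_two, pderiv_zero_incl,
    pderiv_two_incl, dwOp, map_add, map_mul, map_mul, map_mul, incl_C, incl_X_zero, incl_X_two]
  ring

/-- the raising identity, expanded: `Σ_k (E Φ_{l,k}) s^k = Σ_k ((2W∂_W + Z∂_Z) Φ_{l,k}) s^{k+1}`. -/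
theorem sum_raise_Phi (l : ℕ) :
    ∑ j ∈ Finset.range (2 * l + 1), incl (raise (Phi l j)) * X 3 ^ j
      = ∑ j ∈ Finset.range (2 * l + 1), incl (dwOp (Phi l j)) * X 3 ^ (j + 1) := by
  calc ∑ j ∈ Finset.range (2 * l + 1), incl (raise (Phi l j)) * X 3 ^ j
      = raiseG (qs ^ l) := by rw [qs_pow_eq_sum, raiseG_sum]; simp only [raiseG_term]
    _ = X 3 * (C (2 : ℂ) * X 0 * pderiv 0 (qs ^ l) + X 2 * pderiv 2 (qs ^ l)) := raiseG_qs_pow l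
    _ = ∑ j ∈ Finset.range (2 * l + 1), incl (dwOp (Phi l j)) * X 3 ^ (j + 1) := by
        rw [qs_pow_eq_sum, map_sum, map_sum, Finset.mul_sum, Finset.mul_sum, mul_add, Finset.mul_sum, Finset.mul_sum,
          ← Finset.sum_add_distrib]
        simp only [dwOp_term]

/-- ★ THE RAISING LAW ON THE FRAME: `E Φ_{l,k+1} = (2l − k) Φ_{l,k}` (and `E Φ_{l,0} = 0` below). -/
theorem raise_Phi_succ (l k : ℕ) : raise (Phi l (k + 1)) = ((2 * l - k : ℕ) : ℂ) • Phi l k := by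
  by_cases hk : k < 2 * l + 1
  · -- compare coefficients of `s^{k+1}` in the generating identity, padded to the common range `2l+2`
    set b : ℕ → CPoly := fun j => if j = 0 then 0 else dwOp (Phi l (j - 1)) with hb
    have hsum : ∑ j ∈ Finset.range (2 * l + 2), incl (raise (Phi l j)) * X 3 ^ j = ∑ j ∈ Finset.range (2 * l + 2), incl (b j) * X 3 ^ j := by
      rw [Finset.sum_range_succ, sum_raise_Phi, Phi_eq_zero_of_lt (by omega : 2 * l < 2 * l + 1), Finset.sum_range_succ' _ (2 * l + 1)]
      simp [hb, raise]
    have h := eq_of_sum_incl_eq _ _ b hsum (show k + 1 < 2 * l + 2 by omega)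
    simp only [hb, Nat.succ_ne_zero, if_false, Nat.add_sub_cancel] at h
    rw [h, dwOp_eq_smul (isHomogeneous_Phi l k) (isWeightedHomogeneous_Phi l k)]
    congr 1
    have : k ≤ 2 * l := by omega
    push_cast [this]
    ring
  · rw [Phi_eq_zero_of_lt (by omega : 2 * l < k + 1), Phi_eq_zero_of_lt (by omega : 2 * l < k)]
    simp [raise]

/-- `E Φ_{l,0} = E(W^l) = 0`. -/
theorem raise_Phi_zero (l : ℕ) : raise (Phi l 0) = 0 := by
  rw [Phi_zero, raise, pderiv_pow, pderiv_pow, pderiv_X_of_ne (show (0 : Fin 3) ≠ 2 by decide),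
    pderiv_X_of_ne (show (0 : Fin 3) ≠ 1 by decide)]
  ring

/-- ★ the frame elements are non-zero: `Φ_{l,k} ≠ 0` for `k ≤ 2l`. -/
theorem Phi_ne_zero {l k : ℕ} (hk : k ≤ 2 * l) : Phi l k ≠ 0 := by
  induction k with
  | zero => rw [Phi_zero]; exact pow_ne_zero _ (X_ne_zero 0)
  | succ k ih =>
    intro h
    have h1 := raise_Phi_succ l k
    rw [h, raise, map_zero, map_zero, mul_zero, mul_zero, sub_zero] at h1
    have h2 : ((2 * l - k : ℕ) : ℂ) ≠ 0 := by exact_mod_cast (show 2 * l - k ≠ 0 by omega)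
    exact ih (by omega) ((smul_eq_zero.mp h1.symm).resolve_left h2)

/-! ## B. The raising operator is a derivation of the triple product -/

section RaisingLaw

open Summit.NavierStokesRegularity.NavierStokesRegularity.Theorems.PoloidalLiouville.HorizonTower.Zonal (pderiv_comm)

/-- `C 2 = 2` in `ℂ[W,V,Z]`. -/
theorem C_two' : (C (2 : ℂ) : CPoly) = 2 := map_ofNat C 2

/-- ★ THE RAISING LAW: `E = {W, ·}` is a derivation of the triple product,
`E {P, Q} = {E P, Q} + {P, E Q}` (the Jacobi identity of the Lie–Poisson bracket with one slot `= W`). -/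
theorem raise_tripleC (P Q : CPoly) : raise (tripleC P Q) = tripleC (raise P) Q + tripleC P (raise Q) := by
  simp only [raise, tripleC, lam, map_add, map_sub, pderiv_C, pderiv_X_self,
    pderiv_X_of_ne (show (0 : Fin 3) ≠ 1 by decide), pderiv_X_of_ne (show (0 : Fin 3) ≠ 2 by decide),
    pderiv_X_of_ne (show (1 : Fin 3) ≠ 2 by decide),
    pderiv_X_of_ne (show (2 : Fin 3) ≠ 0 by decide), pderiv_X_of_ne (show (2 : Fin 3) ≠ 1 by decide),
    Derivation.leibniz, smul_eq_mul, pderiv_comm 2 0, pderiv_comm 2 1, pderiv_comm 1 0]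
  ring

/-- additivity of `E`. -/
theorem raise_add (P Q : CPoly) : raise (P + Q) = raise P + raise Q := by
  simp only [raise, map_add]; ring

/-- `E` commutes with scalars. -/
theorem raise_smul (c : ℂ) (P : CPoly) : raise (c • P) = c • raise P := by
  simp only [raise, smul_eq_C_mul, pderiv_C_mul]; ring

/-- `E` over finite sums. -/
theorem raise_sum {α : Type*} (s : Finset α) (P : α → CPoly) : raise (∑ a ∈ s, P a) = ∑ a ∈ s, raise (P a) := by
  simp only [raise, map_sum, Finset.mul_sum, Finset.sum_sub_distrib]

/-- `E 0 = 0`. -/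
theorem raise_zero : raise 0 = 0 := by simp [raise]

end RaisingLaw

end Summit.NavierStokesRegularity.NavierStokesRegularity.Theorems.UnthreadedRigidity.VirialHorn.Coherent

end
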